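import Mathlib.LinearAlgebra.Matrix.Adjugate
import Mathlib.RingTheory.Extension.Cotangent.Basic
import Mathlib.RingTheory.Extension.Presentation.Basic
import Mathlib.RingTheory.Etale.Kaehler
import Mathlib.RingTheory.Smooth.Locus
import Mathlib.RingTheory.Flat.Localization
import Mathlib.Algebra.Module.StablyFree.Basic
import Mathlib.RingTheory.Localization.BaseChange
import Literature.AlgebraicGeometry.Resolution.StrictlyStandardElements
import Literature.AlgebraicGeometry.Resolution.NeronPopescuSingularIdeal
import HarnessLib

/-!
# Elkik's lemma: strictly standard elements cut out smooth opens (Stacks 07CA, first half)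

Topic: `Literature/AlgebraicGeometry/Resolution`. The Stacks Project, *Smoothing Ring Maps*
(Tag 07BW), Lemma 07CA (Elkik) for the notion of strictly standard elements of Definition
07C7 (`IsStrictlyStandard`, `StrictlyStandardElements.lean`) and the singular ideal of
Definition 07C5 (`singularIdeal`, `NeronPopescuSingularIdeal.lean`):

> **Lemma 07CA (Elkik).** Let `R → A` be a ring map of finite presentation. The singular
> ideal `H_{A/R}` is the radical of the ideal generated by strictly standard elements in `A`
> over `R` and also the radical of the ideal generated by elementary standard elements in `A`
> over `R`.
>
> *Proof.* Assume `a` is strictly standard in `A` over `R`. We claim that `A_a` is smooth over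
> `R`, which proves that `a ∈ H_{A/R}`. Namely, let `A = R[x_1, …, x_n]/(f_1, …, f_m)`, `c`,
> and `a' ∈ A` be as in Definition 07C7. Write `I = (f_1, …, f_m)` so that the naive cotangent
> complex of `A` over `R` is given by `I/I² → ⊕ A dx_i`. Assumption (16.2.3.4) implies that
> `(I/I²)_a` is generated by the classes of `f_1, …, f_c`. Assumption (16.2.3.3) implies that
> the differential `(I/I²)_a → ⊕ A_a dx_i` has a left inverse, see Lemma 07ET. Hence
> `R → A_a` is smooth by definition and Algebra, Lemma 00S7. […] `H_e ⊂ H_s ⊂ H_{A/R}`. The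
> inclusion `H_{A/R} ⊂ H_e` follows from Lemma 07C6.

This file proves the first half (the claim and the inclusions `H_e ⊆ H_s ⊆ H_{A/R}`):
`IsStrictlyStandard.smooth : IsStrictlyStandard R a → Algebra.Smooth R (Localization.Away a)`,
`IsStrictlyStandard.mem_singularIdeal`, `radical_span_isStrictlyStandard_le_singularIdeal`,
`IsElementaryStandard.smooth`; and, by the same computation, **Lemma 07EZ (d)** ((5) ⇒ (2)):
`IsStrictlyStandard.isStablyFree_kaehlerDifferential`. The reverse inclusion `H_{A/R} ⊆ H_e`
(via Lemma 07C6) is not treated here. Lemma 07ET, in the direction used, is Algebra,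
Lemma 07DQ (1) (`exists_matrix_mul_eq_smul_one`: `t = ∑_p c_p det(J_p)` gives `B` with
`B J = t · 1`, `B = ∑_p c_p adj(J_p) E_p`).

## Rendering of the proof

Mathlib's `Algebra.FormallySmooth R S` is `H¹(L_{S/R}) = 0 ∧ Ω_{S/R}` projective
(`Algebra.FormallySmooth`, Stacks 031J (6)); `Algebra.Smooth` adds finite presentation, which
`A_a` inherits from `A`. For the presentation `P` of `A` given by `IsStrictlyStandard` we use
Mathlib's conormal module `P.toExtension.Cotangent = I/I²`, the cotangent complex
`I/I² → ⊕ A dx_i` and the exact sequence `H¹ → I/I² → ⊕ A dx_i → Ω_{A/R} → 0`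
(`exact_hCotangentι_cotangentComplex`, `exact_cotangentComplex_toKaehler`), base-changed to
`A_a` (flat). (16.2.3.4) gives that `e_k ↦ 1 ⊗ f̄_k : A_a^c → (I/I²)_a` is surjective
(`LiftCond.tmul_mem_span`); (16.2.3.3) and 07DQ (1) give `ψ' = a⁻¹ B : ⊕ A_a dx_i → A_a^c`
with `ψ' ∘ d ∘ (e_k ↦ 1 ⊗ f̄_k) = id`; hence `(I/I²)_a ≅ A_a^c`, `d` is split injective,
`⊕ A_a dx_i ≅ (I/I²)_a ⊕ (A_a ⊗ Ω_{A/R})`, so `Ω_{A_a/R} ≅ A_a ⊗ Ω_{A/R}` is projective and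
stably free, and `H¹(L_{A_a/R}) ≅ (H¹(L_{A/R}))_a` (Mathlib `H1Cotangent.isLocalizedModule`)
vanishes because `A_a ⊗ H¹ → (I/I²)_a` is injective with image `ker d = 0`.

## References

* The Stacks Project, *Smoothing Ring Maps* (Tag 07BW): Lemma 07CA and its proof, Definition
  07C7, Lemmas 07ET, 07EZ (d); *Commutative Algebra*, Lemma 07DQ (1), Lemma 00S7.
  [StacksProject]
* R. Elkik, *Solutions d'équations à coefficients dans un anneau hensélien*, Ann. Sci. ÉNS 6
  (1973) 553–603, §0.2, Lemme 1. [cited through StacksProject]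
-/

noncomputable section

open MvPolynomial TensorProduct

namespace Literature.AlgebraicGeometry.Resolution

universe u

/-! ## Stacks 07DQ (1): a combination of maximal minors gives a left inverse up to `t` -/

section MatrixPart

variable {T : Type*} [CommRing T]

/-- The selection matrix `E_p` times `J` is the row-submatrix `J_p`. [folklore] -/
theorem one_submatrix_mul_eq {c : ℕ} {ι : Type*} [Fintype ι] [DecidableEq ι]
    (J : Matrix ι (Fin c) T) (p : Fin c → ι) :
    (1 : Matrix ι ι T).submatrix p id * J = J.submatrix p id := by
  ext i j
  simp only [Matrix.mul_apply, Matrix.submatrix_apply, id, Matrix.one_apply, ite_mul, one_mul,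
    zero_mul, Finset.sum_ite_eq, Finset.mem_univ, if_true]

/-- **Stacks 07DQ (1)** (for the `c × c` minors of an `ι × c` matrix, indexed by all maps
`p : Fin c → ι`): if `t = ∑_p coef_p det(J_p)` then `B J = t · 1` for some `c × ι` matrix `B`
(namely `B = ∑_p coef_p adj(J_p) E_p`). This is the direction of Lemma 07ET used in Elkik's
Lemma 07CA. [cite: StacksProject, Tag 07DQ] -/
theorem exists_matrix_mul_eq_smul_one {c : ℕ} {ι : Type*} [Fintype ι] [DecidableEq ι]
    (J : Matrix ι (Fin c) T) (coef : (Fin c → ι) → T) (t : T)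
    (h : t = ∑ p : Fin c → ι, coef p * (J.submatrix p id).det) :
    ∃ B : Matrix (Fin c) ι T, B * J = t • (1 : Matrix (Fin c) (Fin c) T) := by
  refine ⟨∑ p, coef p • ((J.submatrix p id).adjugate * (1 : Matrix ι ι T).submatrix p id), ?_⟩
  rw [Matrix.sum_mul, h, Finset.sum_smul]
  refine Finset.sum_congr rfl fun p _ => ?_
  rw [Matrix.smul_mul, Matrix.mul_assoc, one_submatrix_mul_eq, Matrix.adjugate_mul, smul_smul]

end MatrixPart

/-! ## Elkik's lemma 07CA (first half): `a` strictly standard ⇒ `A_a` smooth -/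

section Elkik

variable {R A : Type u} [CommRing R] [CommRing A] [Algebra R A]

/-- The `A`-action on `J/J²` in terms of representatives. [folklore] -/
theorem smul_cotangentMk_eq (Q : Algebra.Extension R A) (s : A) (z : Q.ker) :
    s • Algebra.Extension.Cotangent.mk z = Algebra.Extension.Cotangent.mk (Q.σ s • z) := by
  apply Algebra.Extension.Cotangent.ext
  rw [Algebra.Extension.Cotangent.val_smul, Algebra.Extension.Cotangent.val_mk,
    Algebra.Extension.Cotangent.val_mk, LinearMap.map_smul]

variable {n m : ℕ} (P : Algebra.Presentation R A (Fin n) (Fin m)) {a : A} {c : ℕ} {hcm : c ≤ m}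

set_option backward.isDefEq.respectTransparency false in
/-- (16.2.3.4) in the conormal module: `a · f̄_j ∈ A f̄_1 + … + A f̄_c` for every relation
`f_j` (Stacks 07CA, proof: "Assumption (16.2.3.4) implies that `(I/I²)_a` is generated by the
classes of `f_1, …, f_c`"). [cite: StacksProject, Tag 07CA] -/
theorem LiftCond.smul_mk_relation_mem_span (h : LiftCond P a c hcm) (j : Fin m) :
    a • Algebra.Extension.Cotangent.mk ⟨P.relation j, P.relation_mem_ker j⟩ ∈
      Submodule.span A (Set.range fun k : Fin c => Algebra.Extension.Cotangent.mk
        (⟨P.relation (Fin.castLE hcm k), P.relation_mem_ker _⟩ : P.toExtension.ker)) := by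
  have hmem := h.mem (P.σ a) (P.aeval_val_σ a) j
  obtain ⟨u, hu, v, hv, huv⟩ := Submodule.mem_sup.mp hmem
  obtain ⟨g, hg⟩ := (Ideal.mem_span_range_iff_exists_fun).mp hu
  have hv' : v ∈ P.toExtension.ker := Ideal.pow_le_self two_ne_zero hv
  have hu' : u ∈ P.toExtension.ker := by
    rw [← hg]
    exact Ideal.sum_mem _ fun k _ => Ideal.mul_mem_left _ _ (P.relation_mem_ker _)
  rw [smul_cotangentMk_eq]
  have hsplit : (P.toExtension.σ a • ⟨P.relation j, P.relation_mem_ker j⟩ : P.toExtension.ker) =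
      (∑ k, g k • (⟨P.relation (Fin.castLE hcm k), P.relation_mem_ker _⟩ : P.toExtension.ker)) +
        ⟨v, hv'⟩ := by
    apply Subtype.ext
    rw [Submodule.coe_add, Submodule.coe_sum]
    simp_rw [Submodule.coe_smul, smul_eq_mul]
    change P.σ a * P.relation j = ∑ k, g k * P.relation (Fin.castLE hcm k) + v
    rw [← huv, ← hg]
    rfl
  rw [hsplit, map_add, (Algebra.Extension.Cotangent.mk_eq_zero_iff
    (⟨v, hv'⟩ : P.toExtension.ker)).mpr hv, add_zero, map_sum]
  refine Submodule.sum_mem _ fun k _ => ?_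
  rw [LinearMap.map_smul, ← algebraMap_smul A (g k)]
  exact Submodule.smul_mem _ _ (Submodule.subset_span ⟨k, rfl⟩)

set_option backward.isDefEq.respectTransparency false in
/-- Hence `a · (J/J²) ⊆ A f̄_1 + … + A f̄_c`. [cite: StacksProject, Tag 07CA] -/
theorem LiftCond.smul_mem_span (h : LiftCond P a c hcm) (z : P.toExtension.Cotangent) :
    a • z ∈ Submodule.span A (Set.range fun k : Fin c => Algebra.Extension.Cotangent.mk
        (⟨P.relation (Fin.castLE hcm k), P.relation_mem_ker _⟩ : P.toExtension.ker)) := by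
  have htop := Algebra.Extension.Cotangent.span_eq_top_of_span_eq_ker (P := P.toExtension)
    P.relation P.span_range_relation_eq_ker
  have hz : z ∈ Submodule.span A (Set.range fun j : Fin m =>
      Algebra.Extension.Cotangent.mk (⟨P.relation j, P.relation_mem_ker j⟩ : P.toExtension.ker)) := by
    rw [htop]; exact Submodule.mem_top
  induction hz using Submodule.span_induction with
  | mem x hx =>
    obtain ⟨j, rfl⟩ := hx
    exact h.smul_mk_relation_mem_span P j
  | zero => rw [smul_zero]; exact Submodule.zero_mem _
  | add x y _ _ hx hy => rw [smul_add]; exact Submodule.add_mem _ hx hy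
  | smul r x _ hx => rw [smul_comm]; exact Submodule.smul_mem _ r hx

set_option backward.isDefEq.respectTransparency false in
/-- After localization, `1 ⊗ f̄_1, …, 1 ⊗ f̄_c` span `(J/J²)_a`. [cite: StacksProject, Tag 07CA] -/
theorem LiftCond.tmul_mem_span (h : LiftCond P a c hcm)
    (z : P.toExtension.Cotangent) :
    (1 : Localization.Away a) ⊗ₜ[A] z ∈ Submodule.span (Localization.Away a)
      (Set.range fun k : Fin c => (1 : Localization.Away a) ⊗ₜ[A] Algebra.Extension.Cotangent.mk
        (⟨P.relation (Fin.castLE hcm k), P.relation_mem_ker _⟩ : P.toExtension.ker)) := by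
  have hu : IsUnit (algebraMap A (Localization.Away a) a) := IsLocalization.Away.algebraMap_isUnit a
  have h1 : hu.unit⁻¹ • ((1 : Localization.Away a) ⊗ₜ[A] (a • z)) =
      (1 : Localization.Away a) ⊗ₜ[A] z := by
    rw [tmul_smul, ← algebraMap_smul (Localization.Away a) a]
    exact inv_smul_smul hu.unit ((1 : Localization.Away a) ⊗ₜ[A] z)
  rw [← h1]
  refine Submodule.smul_mem _ _ ?_
  have h2 := Submodule.apply_mem_span_image_of_mem_span
    (TensorProduct.mk A (Localization.Away a) P.toExtension.Cotangent 1) (h.smul_mem_span P z)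
  rw [← Set.range_comp] at h2
  exact Submodule.span_le_restrictScalars A (Localization.Away a) _ h2

set_option backward.isDefEq.respectTransparency false in
/-- Coordinates of the localized cotangent complex: the `i`-th coordinate of `d(1 ⊗ z̄)` in the
basis `1 ⊗ dx_i` is `(∂z/∂x_i)(val)`. [folklore] -/
theorem repr_baseChange_cotangentComplex_tmul_mk {ι : Type} (G : Algebra.Generators R A ι)
    (L : Type u) [CommRing L] [Algebra A L] (z : G.toExtension.ker) (i : ι) :
    (G.cotangentSpaceBasis.baseChange L).repr
      ((G.toExtension.cotangentComplex.baseChange L) ((1 : L) ⊗ₜ[A]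
        Algebra.Extension.Cotangent.mk z)) i =
      algebraMap A L (aeval G.val (pderiv i z.val)) := by
  rw [LinearMap.baseChange_tmul, Algebra.Extension.cotangentComplex_mk,
    Module.Basis.baseChange_repr_tmul, Algebra.Generators.cotangentSpaceBasis_repr_one_tmul,
    Algebra.smul_def, mul_one]

set_option backward.isDefEq.respectTransparency false in
/-- **Elkik's lemma, Stacks 07CA (first half)**, with the by-product 07EZ (d): if `a ∈ A` is
strictly standard in `A` over `R`, then `A_a` is formally smooth over `R` and `Ω_{A_a/R}` is
stably free. Stacks, proof of 07CA: "Assumption (16.2.3.4) implies that `(I/I²)_a` is generated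
by the classes of `f_1, …, f_c`. Assumption (16.2.3.3) implies that the differential
`(I/I²)_a → ⊕ A_a dx_i` has a left inverse, see Lemma 07ET. Hence `R → A_a` is smooth by
definition and Algebra, Lemma 00S7"; proof of 07EZ (d): "`(I/I²)_a` is free on `f_1, …, f_c`
and maps isomorphically to a direct summand of `⊕ A_a dx_i` … we conclude that
[`Ω_{A_a/R}`] is stably free". In Mathlib's language (`Algebra.FormallySmooth` = `H¹(L) = 0`
and `Ω` projective): the left inverse is `ψ' = a⁻¹ B` with `B` from `pow`/minor identity
(07DQ (1)); `A_a^c → (J/J²)_a`, `e_k ↦ 1 ⊗ f̄_k` is surjective by (16.2.3.4) and injective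
because `ψ' ∘ d` inverts it, so `d : (J/J²)_a → ⊕ A_a dx_i` is split injective with free
source; flat base change of `H¹ → J/J² → ⊕ A dx_i → Ω_{A/R} → 0` then gives
`H¹(L_{A_a/R}) = H¹(L_{A/R})_a = 0` and `Ω_{A_a/R} ⊕ A_a^c ≅ A_a^n`.
[cite: StacksProject, Tag 07CA] -/
theorem IsStrictlyStandard.formallySmooth_and_isStablyFree {a : A} (h : IsStrictlyStandard R a) :
    Algebra.FormallySmooth R (Localization.Away a) ∧
      Module.IsStablyFree (Localization.Away a) (Ω[Localization.Away a⁄R]) := by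
  classical
  obtain ⟨n, m, P, c, hcn, hcm, ⟨coef, h33⟩, h34⟩ := h
  -- notation
  haveI : Algebra.FinitePresentation R A := P.finitePresentation_of_isFinite
  set L := Localization.Away a with hL
  let f : Fin c → P.toExtension.ker := fun k => ⟨P.relation (Fin.castLE hcm k), P.relation_mem_ker _⟩
  let dL : L ⊗[A] P.toExtension.Cotangent →ₗ[L] L ⊗[A] P.toExtension.CotangentSpace :=
    P.toExtension.cotangentComplex.baseChange L
  let gL : L ⊗[A] P.toExtension.CotangentSpace →ₗ[L] L ⊗[A] (Ω[A⁄R]) :=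
    P.toExtension.toKaehler.baseChange L
  have hexact : Function.Exact dL gL :=
    Module.Flat.lTensor_exact L P.toExtension.exact_cotangentComplex_toKaehler
  have hgL : Function.Surjective gL := LinearMap.lTensor_surjective L P.toExtension.toKaehler_surjective
  let bS := P.cotangentSpaceBasis.baseChange L
  -- Step 1: the matrix `B` with `B · Jac = a · 1` (07DQ (1) applied to (16.2.3.3))
  let Jac : Matrix (Fin n) (Fin c) A :=
    Matrix.of fun i j => aeval P.val (pderiv i (P.relation (Fin.castLE hcm j)))
  have hJac : a = ∑ p : Fin c → Fin n, coef p * (Jac.submatrix p id).det := by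
    rw [h33]
    refine Finset.sum_congr rfl fun p _ => ?_
    congr 1
    rw [jacobianMinor, AlgHom.map_det, AlgHom.mapMatrix_apply]
    rfl
  obtain ⟨B, hB⟩ := exists_matrix_mul_eq_smul_one Jac coef a hJac
  -- Step 2: `φ : A_a^c → (J/J²)_a` and `ψ : ⊕ A_a dx_i → A_a^c` with `ψ ∘ d ∘ φ = a`
  let φ : (Fin c → L) →ₗ[L] L ⊗[A] P.toExtension.Cotangent :=
    Fintype.linearCombination L fun k => (1 : L) ⊗ₜ[A] Algebra.Extension.Cotangent.mk (f k)
  let ψ : L ⊗[A] P.toExtension.CotangentSpace →ₗ[L] (Fin c → L) :=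
    (B.map (algebraMap A L)).mulVecLin ∘ₗ
      ((Finsupp.linearEquivFunOnFinite L L (Fin n)).toLinearMap ∘ₗ bS.repr.toLinearMap)
  have hψφ : ψ ∘ₗ dL ∘ₗ φ = algebraMap A L a • LinearMap.id := by
    refine LinearMap.pi_ext' fun k => LinearMap.ext_ring ?_
    funext k'
    simp only [LinearMap.coe_comp, Function.comp_apply, LinearMap.smul_apply, LinearMap.id_apply,
      LinearMap.coe_single]
    rw [show φ (Pi.single k 1) = (1 : L) ⊗ₜ[A] Algebra.Extension.Cotangent.mk (f k) by
      simp [φ, Fintype.linearCombination_apply_single]]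
    change (B.map (algebraMap A L)).mulVec
      (fun i => (P.cotangentSpaceBasis.baseChange L).repr
        ((P.toExtension.cotangentComplex.baseChange L)
          ((1 : L) ⊗ₜ[A] Algebra.Extension.Cotangent.mk (f k))) i) k' = _
    simp_rw [repr_baseChange_cotangentComplex_tmul_mk]
    rw [Matrix.mulVec, dotProduct]
    have hterm : ∀ i, (B.map (algebraMap A L)) k' i *
        algebraMap A L (aeval P.val (pderiv i (f k).val)) = algebraMap A L (B k' i * Jac i k) :=
      fun i => by rw [Matrix.map_apply, ← map_mul]; rfl
    rw [Finset.sum_congr rfl fun i _ => hterm i, ← map_sum, ← Matrix.mul_apply, hB,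
      Matrix.smul_apply, Matrix.one_apply, Pi.smul_apply, Pi.single_apply, smul_eq_mul,
      smul_eq_mul, map_mul]
    split_ifs <;> simp
  have hu : IsUnit (algebraMap A L a) := IsLocalization.Away.algebraMap_isUnit a
  let ψ' : L ⊗[A] P.toExtension.CotangentSpace →ₗ[L] (Fin c → L) := hu.unit⁻¹ • ψ
  have hψ'φ : ψ' ∘ₗ dL ∘ₗ φ = LinearMap.id := by
    change (hu.unit⁻¹ • ψ) ∘ₗ dL ∘ₗ φ = LinearMap.id
    rw [LinearMap.smul_comp, hψφ]
    change hu.unit⁻¹ • (hu.unit • (LinearMap.id : (Fin c → L) →ₗ[L] (Fin c → L))) = LinearMap.id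
    exact inv_smul_smul hu.unit _
  have hli : ∀ v, ψ' (dL (φ v)) = v := fun v => LinearMap.congr_fun hψ'φ v
  -- Step 3: `φ` is surjective by (16.2.3.4)
  have hφsurj : Function.Surjective φ := by
    rw [← LinearMap.range_eq_top, Fintype.range_linearCombination, Submodule.eq_top_iff']
    intro w
    induction w using TensorProduct.induction_on with
    | zero => exact Submodule.zero_mem _
    | tmul l z =>
      rw [show l ⊗ₜ[A] z = l • ((1 : L) ⊗ₜ[A] z) by
        rw [TensorProduct.smul_tmul', smul_eq_mul, mul_one]]
      exact Submodule.smul_mem _ l (h34.tmul_mem_span P z)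
    | add w₁ w₂ h₁ h₂ => exact Submodule.add_mem _ h₁ h₂
  -- Step 4: `φ` is injective (`ψ' ∘ d` is a left inverse), hence bijective
  have hφinj : Function.Injective φ :=
    Function.LeftInverse.injective (g := fun w => ψ' (dL w)) hli
  let eφ : (Fin c → L) ≃ₗ[L] L ⊗[A] P.toExtension.Cotangent :=
    LinearEquiv.ofBijective φ ⟨hφinj, hφsurj⟩
  -- Step 5: `φ ∘ ψ'` is a retraction of `dL`; in particular `dL` is injective
  have hret : (φ ∘ₗ ψ') ∘ₗ dL = LinearMap.id := by
    refine LinearMap.ext fun w => ?_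
    obtain ⟨v, rfl⟩ := hφsurj w
    change φ (ψ' (dL (φ v))) = φ v
    rw [hli v]
  have hdLinj : Function.Injective dL :=
    Function.LeftInverse.injective (g := fun w => φ (ψ' w)) fun w => LinearMap.congr_fun hret w
  -- Step 6: the localized conormal sequence splits
  have h13 := hexact.split_tfae'.out 1 2
  obtain ⟨e, -, -⟩ := h13.mp ⟨hgL, _, hret⟩
  -- Step 7a: `Ω_{A_a/R}` is projective and stably free
  have hprojΩA : Module.Projective L (L ⊗[A] (Ω[A⁄R])) :=
    Module.Projective.of_split (e.symm.toLinearMap ∘ₗ LinearMap.inr L _ _)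
      (LinearMap.snd L _ _ ∘ₗ e.toLinearMap) (LinearMap.ext fun w => by simp)
  let eΩ : L ⊗[A] (Ω[A⁄R]) ≃ₗ[L] (Ω[L⁄R]) :=
    (IsLocalizedModule.isBaseChange (Submonoid.powers a) L (KaehlerDifferential.map R R A L)).equiv
  have hprojΩ : Module.Projective L (Ω[L⁄R]) := Module.Projective.of_equiv eΩ
  have hsf : Module.IsStablyFree L (Ω[L⁄R]) := by
    haveI : Module.Free L ((Fin c → L) × (L ⊗[A] (Ω[A⁄R]))) :=
      Module.Free.of_equiv ((eφ.prodCongr (LinearEquiv.refl L _)).trans e.symm).symm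
    haveI : Module.IsStablyFree L (L ⊗[A] (Ω[A⁄R])) :=
      Module.IsStablyFree.of_free_prod' L _ (Fin c → L)
    exact Module.IsStablyFree.equiv eΩ
  -- Step 7b: `H¹(L_{A_a/R}) = (H¹(L_{A/R}))_a = 0`
  have hH1 : Subsingleton (Algebra.H1Cotangent R L) := by
    have hex := Module.Flat.lTensor_exact L P.toExtension.exact_hCotangentι_cotangentComplex
    have hinj := Module.Flat.lTensor_preserves_injective_linearMap (M := L)
      P.toExtension.h1Cotangentι P.toExtension.h1Cotangentι_injective
    have hsub : Subsingleton (L ⊗[A] P.toExtension.H1Cotangent) := by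
      refine ⟨fun w₁ w₂ => hinj ?_⟩
      have hz : ∀ w, (P.toExtension.h1Cotangentι.lTensor L) w = 0 := fun w =>
        hdLinj (by rw [map_zero]; exact (hex _).mpr ⟨w, rfl⟩)
      rw [hz, hz]
    let e₁ := LinearEquiv.lTensor L P.equivH1Cotangent
    let e₂ := IsLocalizedModule.linearEquiv (Submonoid.powers a)
      (TensorProduct.mk A L (Algebra.H1Cotangent R A) 1) (Algebra.H1Cotangent.map R R A L)
    exact (e₂.symm.trans e₁.symm).toEquiv.subsingleton
  exact ⟨⟨hprojΩ, hH1⟩, hsf⟩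

/-- **Elkik's lemma (Stacks 07CA), first half: a strictly standard element lies in the
singular ideal, i.e. `A_a` is formally smooth over `R`.** [cite: StacksProject, Tag 07CA] -/
theorem IsStrictlyStandard.formallySmooth {a : A} (h : IsStrictlyStandard R a) :
    Algebra.FormallySmooth R (Localization.Away a) :=
  h.formallySmooth_and_isStablyFree.1

/-- **Stacks 07CA (Elkik)**: "Assume `a` is strictly standard in `A` over `R`. We claim that
`A_a` is smooth over `R`". [cite: StacksProject, Tag 07CA] -/
theorem IsStrictlyStandard.smooth {a : A} (h : IsStrictlyStandard R a) :
    Algebra.Smooth R (Localization.Away a) := by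
  haveI := h.finitePresentation
  haveI : Algebra.FinitePresentation A (Localization.Away a) :=
    IsLocalization.Away.finitePresentation a
  exact ⟨h.formallySmooth, .trans R A _⟩

/-- **Stacks 07CA (Elkik)**: "… which proves that `a ∈ H_{A/R}`" — a strictly standard element
lies in the singular ideal `H_{A/R}` (`singularIdeal`, Stacks 07C5).
[cite: StacksProject, Tag 07CA] -/
theorem IsStrictlyStandard.mem_singularIdeal {a : A} (h : IsStrictlyStandard R a) :
    a ∈ singularIdeal R A := by
  haveI := h.finitePresentation
  exact mem_singularIdeal_iff_smooth.mpr h.smooth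

/-- **Stacks 07EZ (d)**, (5) ⇒ (2): if `a` is strictly standard in `A` over `R` then
`Ω_{A_a/R}` is stably free. [cite: StacksProject, Tag 07EZ] -/
theorem IsStrictlyStandard.isStablyFree_kaehlerDifferential {a : A} (h : IsStrictlyStandard R a) :
    Module.IsStablyFree (Localization.Away a) (Ω[Localization.Away a⁄R]) :=
  h.formallySmooth_and_isStablyFree.2

/-- Elementary standard elements lie in the singular ideal too (Stacks 07CA: "and also the
radical of the ideal generated by elementary standard elements", the inclusion `H_e ⊆ H_{A/R}`).
[cite: StacksProject, Tag 07CA] -/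
theorem IsElementaryStandard.smooth {a : A} (h : IsElementaryStandard R a) :
    Algebra.Smooth R (Localization.Away a) :=
  h.isStrictlyStandard.smooth

/-- `H_s ⊆ H_{A/R}`: the radical of the ideal generated by the strictly standard elements is
contained in the singular ideal (the inclusion of Elkik's lemma 07CA proved here; the reverse
inclusion needs Lemma 07C6). [cite: StacksProject, Tag 07CA] -/
theorem radical_span_isStrictlyStandard_le_singularIdeal [Algebra.FinitePresentation R A] :
    (Ideal.span {a : A | IsStrictlyStandard R a}).radical ≤ singularIdeal R A := by
  rw [Ideal.IsRadical.radical_le_iff isRadical_singularIdeal, Ideal.span_le]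
  exact fun a ha => IsStrictlyStandard.mem_singularIdeal ha

end Elkik

end Literature.AlgebraicGeometry.Resolution

end
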